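import Summits.CriticalPhenomena.PercolationContinuityZ3.Theorems.PercNearOneGluingAdditiveGluingChartF2Pointwise
import Summits.CriticalPhenomena.PercolationContinuityZ3.Theorems.PercNearOneGluingAdditiveGluingLincombIntegral
import Summits.CriticalPhenomena.PercolationContinuityZ3.Theorems.PercNearOneGluingAdditiveGluingCrossAnyOneTwo
import Summits.CriticalPhenomena.PercolationContinuityZ3.Theorems.PercNearOneGluingAdditiveGluingCrossAnyTwoOne
import Summits.CriticalPhenomena.PercolationContinuityZ3.Theorems.PercNearOneGluingAdditiveGluingExchangePlain
import Summits.CriticalPhenomena.PercolationContinuityZ3.Theorems.PercNearOneGluingAdditiveGluingExchangeHas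
import Summits.CriticalPhenomena.PercolationContinuityZ3.Theorems.PercNearOneGluingAdditiveGluingExchangeAvoid
import HarnessLib

/-!
# Chart F2 of the three-relay certificate — assembly (lead c7)

For three distinct relays `a₁ a₂ a₃` with `τ₃ ≤ τ₁`, `τ₃ ≤ τ₂` (`τ_x = μ(x ↔ b)`), the Kozma–Nitzan-type certificate
`slack = (X2) + κ(X13) + φ₂(T2) + t_h(T1h) + t_a(T1a) − Σ ζ_X E_X + R` with `R ≥ 0` patternwise proves
`μ(o ↔ A, o ↮ b) ≤ μ(a₃ ↮ b)` on the chart region `2Φ ≤ 1 − φ₂`, `Φ + κ ≤ 1` (conditional attachments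
`φ_X = μ(o ↔ A(X) | N_X)`, `Φ = φ₂(φ₁/d₁ + φ₃/d₃)`).  Ingredients: BHK 2006 Thm 1.4 cross atoms (`stub_crossAnyOneTwo_c7`,
`stub_crossAnyTwoOne_c7`), KN Lemma 3 exchanges (`stub_exchangePlain/Has/Avoid_c7`), the generated 52-pattern bookkeeping
`chartF2_pointwise`, and the integration step `stub_lincombIntegral_c7`.
[cite: KozmaNitzan2024, Theorem 2 (§3.1, pp. 8–9), Lemma 3 (p. 7); VandenbergHaggstromKahn2005, Thm. 1.4 (p. 7)]
-/

namespace Summit.CriticalPhenomena.PercolationContinuityZ3.Theorems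

open MeasureTheory Set Literature.Probability.LatticeModels Literature.Probability.Percolation
open scoped Classical

variable {n : ℕ}

/-- **Chart F2, coefficient instantiation.**  With `q' = q − p₂`, `th = 1 − p₂ − Φ₁ − Φ₃`, `ta = Φ₁ + Φ₃`, `z₁ = p₂ + Φ₁`,
`z₂₃ = Φ₁`, `z₃ = p₂ + Φ₃`, `z₁₂ = Φ₃` and primed coefficients with `z₁' + z₂₃' ≤ Φ₁`, `z₃' + z₁₂' ≤ Φ₃`, the per-pattern
inequalities of `chartF2_pointwise` follow from `condA : 2(Φ₁+Φ₃) ≤ 1 − p₂` and `condB : Φ₁ + Φ₃ + q ≤ 1` by linear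
arithmetic. [cite: KozmaNitzan2024, Theorem 2 (§3.1, pp. 8–9)] -/
theorem chartF2_pointwise_inst (n : ℕ) (o b a₁ a₂ a₃ : Fin n) (p₂ q Φ₁ Φ₃ z₁' z₂₃' z₃' z₁₂' : ℝ)
    (hp₂0 : 0 ≤ p₂) (hΦ₁0 : 0 ≤ Φ₁) (hΦ₃0 : 0 ≤ Φ₃)
    (hS₁ : z₁' + z₂₃' ≤ Φ₁) (hS₃ : z₃' + z₁₂' ≤ Φ₃)
    (condA : 2 * (Φ₁ + Φ₃) ≤ 1 - p₂) (condB : Φ₁ + Φ₃ + q ≤ 1) (ω : BondConfig (Fin n)) :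
    0 ≤ (([(1, (openConn a₃ b)ᶜ),
      (-1, ((openConn o a₁ ∪ openConn o a₂ ∪ openConn o a₃) \ openConn o b)),
      (-p₂, (((openConn a₂ a₁)ᶜ ∩ (openConn a₂ a₃)ᶜ) ∩ (openConn a₁ b ∪ openConn a₃ b))),
      (1, (((openConn a₂ a₁)ᶜ ∩ (openConn a₂ a₃)ᶜ) ∩ (openConn a₂ o ∩ (openConn a₁ b ∪ openConn a₃ b)))),
      (-(q - p₂), (((openConn a₂ a₁)ᶜ ∩ (openConn a₂ a₃)ᶜ) ∩ openConn a₂ b)),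
      (q, (((openConn a₂ a₁)ᶜ ∩ (openConn a₂ a₃)ᶜ) ∩ ((openConn a₁ o ∪ openConn a₃ o) ∩ openConn a₂ b))),
      (-p₂, (openConn a₂ b ∩ (openConn a₃ a₂)ᶜ)),
      (p₂, (openConn a₃ b ∩ (openConn a₃ a₂)ᶜ)),
      (-(1 - p₂ - Φ₁ - Φ₃), ((openConn a₁ b ∩ (openConn a₃ a₁)ᶜ) ∩ openConn a₁ o)),
      ((1 - p₂ - Φ₁ - Φ₃), ((openConn a₃ b ∩ (openConn a₃ a₁)ᶜ) ∩ openConn a₁ o)),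
      (-(Φ₁ + Φ₃), ((openConn a₁ b ∩ (openConn a₃ a₁)ᶜ) ∩ (openConn a₃ o)ᶜ)),
      ((Φ₁ + Φ₃), ((openConn a₃ b ∩ (openConn a₃ a₁)ᶜ) ∩ (openConn a₃ o)ᶜ)),
      ((p₂ + Φ₁), (((openConn a₁ a₂)ᶜ ∩ (openConn a₁ a₃)ᶜ) ∩ openConn a₁ o)),
      (-z₁', ((openConn a₁ a₂)ᶜ ∩ (openConn a₁ a₃)ᶜ)),
      (Φ₁, (((openConn a₁ a₂)ᶜ ∩ (openConn a₁ a₃)ᶜ) ∩ (openConn a₂ o ∪ openConn a₃ o))),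
      (-z₂₃', ((openConn a₁ a₂)ᶜ ∩ (openConn a₁ a₃)ᶜ)),
      ((p₂ + Φ₃), (((openConn a₃ a₁)ᶜ ∩ (openConn a₃ a₂)ᶜ) ∩ openConn a₃ o)),
      (-z₃', ((openConn a₃ a₁)ᶜ ∩ (openConn a₃ a₂)ᶜ)),
      (Φ₃, (((openConn a₃ a₁)ᶜ ∩ (openConn a₃ a₂)ᶜ) ∩ (openConn a₁ o ∪ openConn a₂ o))),
      (-z₁₂', ((openConn a₃ a₁)ᶜ ∩ (openConn a₃ a₂)ᶜ))] : List (ℝ × Set (BondConfig (Fin n)))).map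
      fun ce => ce.1 * ce.2.indicator (1 : BondConfig (Fin n) → ℝ) ω).sum :=
  chartF2_pointwise n o b a₁ a₂ a₃ p₂ q (q - p₂) (1 - p₂ - Φ₁ - Φ₃) (Φ₁ + Φ₃)
    (p₂ + Φ₁) z₁' Φ₁ z₂₃' (p₂ + Φ₃) z₃' Φ₃ z₁₂'
    (by linarith only [hp₂0, hΦ₁0, hΦ₃0, hS₁, hS₃, condA, condB])
    (by linarith only [hp₂0, hΦ₁0, hΦ₃0, hS₁, hS₃, condA, condB])
    (by linarith only [hp₂0, hΦ₁0, hΦ₃0, hS₁, hS₃, condA, condB])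
    (by linarith only [hp₂0, hΦ₁0, hΦ₃0, hS₁, hS₃, condA, condB])
    (by linarith only [hp₂0, hΦ₁0, hΦ₃0, hS₁, hS₃, condA, condB])
    (by linarith only [hp₂0, hΦ₁0, hΦ₃0, hS₁, hS₃, condA, condB])
    (by linarith only [hp₂0, hΦ₁0, hΦ₃0, hS₁, hS₃, condA, condB])
    (by linarith only [hp₂0, hΦ₁0, hΦ₃0, hS₁, hS₃, condA, condB])
    (by linarith only [hp₂0, hΦ₁0, hΦ₃0, hS₁, hS₃, condA, condB])
    (by linarith only [hp₂0, hΦ₁0, hΦ₃0, hS₁, hS₃, condA, condB])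
    (by linarith only [hp₂0, hΦ₁0, hΦ₃0, hS₁, hS₃, condA, condB])
    (by linarith only [hp₂0, hΦ₁0, hΦ₃0, hS₁, hS₃, condA, condB])
    (by linarith only [hp₂0, hΦ₁0, hΦ₃0, hS₁, hS₃, condA, condB])
    (by linarith only [hp₂0, hΦ₁0, hΦ₃0, hS₁, hS₃, condA, condB])
    (by linarith only [hp₂0, hΦ₁0, hΦ₃0, hS₁, hS₃, condA, condB])
    (by linarith only [hp₂0, hΦ₁0, hΦ₃0, hS₁, hS₃, condA, condB])
    (by linarith only [hp₂0, hΦ₁0, hΦ₃0, hS₁, hS₃, condA, condB])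
    (by linarith only [hp₂0, hΦ₁0, hΦ₃0, hS₁, hS₃, condA, condB])
    (by linarith only [hp₂0, hΦ₁0, hΦ₃0, hS₁, hS₃, condA, condB])
    (by linarith only [hp₂0, hΦ₁0, hΦ₃0, hS₁, hS₃, condA, condB])
    (by linarith only [hp₂0, hΦ₁0, hΦ₃0, hS₁, hS₃, condA, condB])
    (by linarith only [hp₂0, hΦ₁0, hΦ₃0, hS₁, hS₃, condA, condB])
    (by linarith only [hp₂0, hΦ₁0, hΦ₃0, hS₁, hS₃, condA, condB])
    (by linarith only [hp₂0, hΦ₁0, hΦ₃0, hS₁, hS₃, condA, condB])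
    (by linarith only [hp₂0, hΦ₁0, hΦ₃0, hS₁, hS₃, condA, condB])
    (by linarith only [hp₂0, hΦ₁0, hΦ₃0, hS₁, hS₃, condA, condB])
    (by linarith only [hp₂0, hΦ₁0, hΦ₃0, hS₁, hS₃, condA, condB])
    (by linarith only [hp₂0, hΦ₁0, hΦ₃0, hS₁, hS₃, condA, condB])
    (by linarith only [hp₂0, hΦ₁0, hΦ₃0, hS₁, hS₃, condA, condB])
    (by linarith only [hp₂0, hΦ₁0, hΦ₃0, hS₁, hS₃, condA, condB])
    (by linarith only [hp₂0, hΦ₁0, hΦ₃0, hS₁, hS₃, condA, condB]) ω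

/-- **Chart F2 (three relays, `a₃` no better than `a₁, a₂`).**  The parameters `p₂ ~ φ₂`, `q ~ κ = φ₂/(1−φ₁₃)`,
`Φ₁ ~ φ₂φ₁/d₁`, `Φ₃ ~ φ₂φ₃/d₃` are supplied by the caller through their defining equations (division-free), together with
the chart conditions `condA : 2(Φ₁+Φ₃) ≤ 1 − p₂` and `condB : Φ₁ + Φ₃ + q ≤ 1`; conclusion `μ(o↔A ∖ o↔b) ≤ μ(a₃ ↮ b)`.
[cite: KozmaNitzan2024, Theorem 2 (§3.1, pp. 8–9)] -/
theorem chartF2_slack : ∀ (n : ℕ) (w : Sym2 (Fin n) → unitInterval) (o b a₁ a₂ a₃ : Fin n) (h12 : a₁ ≠ a₂) (h23 : a₂ ≠ a₃) (hτ31 : (prodBernoulli w).real (openConn a₃ b) ≤ (prodBernoulli w).real (openConn a₁ b)) (hτ32 : (prodBernoulli w).real (openConn a₃ b) ≤ (prodBernoulli w).real (openConn a₂ b)) (p₂ q Φ₁ Φ₃ : ℝ) (hp₂0 : 0 ≤ p₂) (hq0 : 0 ≤ q) (hΦ₁0 : 0 ≤ Φ₁) (hΦ₃0 : 0 ≤ Φ₃)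 (hp₂ : p₂ * (prodBernoulli w).real ((openConn a₂ a₁)ᶜ ∩ (openConn a₂ a₃)ᶜ) = (prodBernoulli w).real (((openConn a₂ a₁)ᶜ ∩ (openConn a₂ a₃)ᶜ) ∩ openConn a₂ o)) (hq : q * ((prodBernoulli w).real ((openConn a₂ a₁)ᶜ ∩ (openConn a₂ a₃)ᶜ) - (prodBernoulli w).real (((openConn a₂ a₁)ᶜ ∩ (openConn a₂ a₃)ᶜ) ∩ (openConn a₁ o ∪ openConn a₃ o))) = (prodBernoulli w).real (((openConn a₂ a₁)ᶜ ∩ (openConn a₂ a₃)ᶜ) ∩ openConn a₂ o)) (hd₁ : (prodBernoulli w).real (((openConn a₁ a₂)ᶜ ∩ (openConn a₁ a₃)ᶜ) ∩ openConn a₁ o) + (prodBernoulli w).real (((openConn a₁ a₂)ᶜ ∩ (openConn a₁ a₃)ᶜ) ∩ (openConn a₂ o ∪ openConn a₃ o)) < (prodBernoulli w).real ((openConn a₁ a₂)ᶜ ∩ (openConn a₁ a₃)ᶜ)) (hΦ₁ : Φ₁ * ((prodBernoulli w).real ((openConn a₁ a₂)ᶜ ∩ (openConn a₁ a₃)ᶜ)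 - (prodBernoulli w).real (((openConn a₁ a₂)ᶜ ∩ (openConn a₁ a₃)ᶜ) ∩ openConn a₁ o) - (prodBernoulli w).real (((openConn a₁ a₂)ᶜ ∩ (openConn a₁ a₃)ᶜ) ∩ (openConn a₂ o ∪ openConn a₃ o))) = p₂ * (prodBernoulli w).real (((openConn a₁ a₂)ᶜ ∩ (openConn a₁ a₃)ᶜ) ∩ openConn a₁ o)) (hd₃ : (prodBernoulli w).real (((openConn a₃ a₁)ᶜ ∩ (openConn a₃ a₂)ᶜ) ∩ openConn a₃ o) + (prodBernoulli w).real (((openConn a₃ a₁)ᶜ ∩ (openConn a₃ a₂)ᶜ) ∩ (openConn a₁ o ∪ openConn a₂ o)) < (prodBernoulli w).real ((openConn a₃ a₁)ᶜ ∩ (openConn a₃ a₂)ᶜ)) (hΦ₃ : Φ₃ * ((prodBernoulli w).real ((openConn a₃ a₁)ᶜ ∩ (openConn a₃ a₂)ᶜ) - (prodBernoulli w).real (((openConn a₃ a₁)ᶜ ∩ (openConn a₃ a₂)ᶜ) ∩ openConn a₃ o) - (prodBernoulli w).real (((openConn a₃ a₁)ᶜ ∩ (openConn a₃ a₂)ᶜ)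 ∩ (openConn a₁ o ∪ openConn a₂ o))) = p₂ * (prodBernoulli w).real (((openConn a₃ a₁)ᶜ ∩ (openConn a₃ a₂)ᶜ) ∩ openConn a₃ o)) (condA : 2 * (Φ₁ + Φ₃) ≤ 1 - p₂) (condB : Φ₁ + Φ₃ + q ≤ 1), (prodBernoulli w).real ((openConn o a₁ ∪ openConn o a₂ ∪ openConn o a₃) \ openConn o b) ≤ (prodBernoulli w).real ((openConn a₃ b)ᶜ) := by
  intro n w o b a₁ a₂ a₃ h12 h23 hτ31 hτ32 p₂ q Φ₁ Φ₃ hp₂0 hq0 hΦ₁0 hΦ₃0 hp₂ hq hd₁ hΦ₁ hd₃ hΦ₃ condA condB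
  have hnn : ∀ s : Set (BondConfig (Fin n)), 0 ≤ (prodBernoulli w).real s := fun _ => measureReal_nonneg
  have hmono : ∀ s t : Set (BondConfig (Fin n)), s ⊆ t → (prodBernoulli w).real s ≤ (prodBernoulli w).real t :=
    fun s t hst => measureReal_mono hst
  have hv₁ : 0 < (prodBernoulli w).real ((openConn a₁ a₂)ᶜ ∩ (openConn a₁ a₃)ᶜ) := by
    have := hnn (((openConn a₁ a₂)ᶜ ∩ (openConn a₁ a₃)ᶜ) ∩ openConn a₁ o); have := hnn (((openConn a₁ a₂)ᶜ ∩ (openConn a₁ a₃)ᶜ) ∩ (openConn a₂ o ∪ openConn a₃ o)); linarith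
  have hv₃ : 0 < (prodBernoulli w).real ((openConn a₃ a₁)ᶜ ∩ (openConn a₃ a₂)ᶜ) := by
    have := hnn (((openConn a₃ a₁)ᶜ ∩ (openConn a₃ a₂)ᶜ) ∩ openConn a₃ o); have := hnn (((openConn a₃ a₁)ᶜ ∩ (openConn a₃ a₂)ᶜ) ∩ (openConn a₁ o ∪ openConn a₂ o)); linarith
  -- the five atoms
  have X2 := stub_crossAnyOneTwo_c7 n w a₂ a₁ a₃ o b h12.symm h23
  have X13 := stub_crossAnyTwoOne_c7 n w a₁ a₃ a₂ o b h12 h23.symm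
  rw [knThm2_openConn_comm a₁ a₂, knThm2_openConn_comm a₃ a₂] at X13
  have T2 := stub_exchangePlain_c7 n w a₃ a₂ b hτ32
  have T1h := stub_exchangeHas_c7 n w a₃ a₁ o b hτ31
  have T1a := stub_exchangeAvoid_c7 n w a₃ a₁ o b hτ31
  -- gaps of the cross atoms in `φ`-form
  have hA2le : (prodBernoulli w).real (((openConn a₂ a₁)ᶜ ∩ (openConn a₂ a₃)ᶜ) ∩ (openConn a₂ o ∩ (openConn a₁ b ∪ openConn a₃ b))) ≤ (prodBernoulli w).real ((openConn a₂ a₁)ᶜ ∩ (openConn a₂ a₃)ᶜ) := hmono _ _ (fun ω hω => hω.1)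
  have hA13le : (prodBernoulli w).real (((openConn a₂ a₁)ᶜ ∩ (openConn a₂ a₃)ᶜ) ∩ ((openConn a₁ o ∪ openConn a₃ o) ∩ openConn a₂ b)) ≤ (prodBernoulli w).real ((openConn a₂ a₁)ᶜ ∩ (openConn a₂ a₃)ᶜ) := hmono _ _ (fun ω hω => hω.1)
  have hB13le : (prodBernoulli w).real (((openConn a₂ a₁)ᶜ ∩ (openConn a₂ a₃)ᶜ) ∩ openConn a₂ b) ≤ (prodBernoulli w).real ((openConn a₂ a₁)ᶜ ∩ (openConn a₂ a₃)ᶜ) := hmono _ _ (fun ω hω => hω.1)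
  have hu13le : (prodBernoulli w).real (((openConn a₂ a₁)ᶜ ∩ (openConn a₂ a₃)ᶜ) ∩ (openConn a₁ o ∪ openConn a₃ o)) ≤ (prodBernoulli w).real ((openConn a₂ a₁)ᶜ ∩ (openConn a₂ a₃)ᶜ) := hmono _ _ (fun ω hω => hω.1)
  have gX2 : (prodBernoulli w).real (((openConn a₂ a₁)ᶜ ∩ (openConn a₂ a₃)ᶜ) ∩ (openConn a₂ o ∩ (openConn a₁ b ∪ openConn a₃ b))) ≤ p₂ * (prodBernoulli w).real (((openConn a₂ a₁)ᶜ ∩ (openConn a₂ a₃)ᶜ) ∩ (openConn a₁ b ∪ openConn a₃ b)) := by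
    rcases eq_or_lt_of_le (hnn ((openConn a₂ a₁)ᶜ ∩ (openConn a₂ a₃)ᶜ)) with hv | hv
    · have h0 : (prodBernoulli w).real (((openConn a₂ a₁)ᶜ ∩ (openConn a₂ a₃)ᶜ) ∩ (openConn a₂ o ∩ (openConn a₁ b ∪ openConn a₃ b))) = 0 := le_antisymm (by linarith) (hnn _)
      rw [h0]; exact mul_nonneg hp₂0 (hnn _)
    · have key : (prodBernoulli w).real ((openConn a₂ a₁)ᶜ ∩ (openConn a₂ a₃)ᶜ) * (prodBernoulli w).real (((openConn a₂ a₁)ᶜ ∩ (openConn a₂ a₃)ᶜ) ∩ (openConn a₂ o ∩ (openConn a₁ b ∪ openConn a₃ b))) ≤ (prodBernoulli w).real ((openConn a₂ a₁)ᶜ ∩ (openConn a₂ a₃)ᶜ) * (p₂ * (prodBernoulli w).real (((openConn a₂ a₁)ᶜ ∩ (openConn a₂ a₃)ᶜ) ∩ (openConn a₁ b ∪ openConn a₃ b))) := by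
        calc (prodBernoulli w).real ((openConn a₂ a₁)ᶜ ∩ (openConn a₂ a₃)ᶜ) * (prodBernoulli w).real (((openConn a₂ a₁)ᶜ ∩ (openConn a₂ a₃)ᶜ) ∩ (openConn a₂ o ∩ (openConn a₁ b ∪ openConn a₃ b))) ≤ (prodBernoulli w).real (((openConn a₂ a₁)ᶜ ∩ (openConn a₂ a₃)ᶜ) ∩ openConn a₂ o) * (prodBernoulli w).real (((openConn a₂ a₁)ᶜ ∩ (openConn a₂ a₃)ᶜ) ∩ (openConn a₁ b ∪ openConn a₃ b)) := X2
          _ = (prodBernoulli w).real ((openConn a₂ a₁)ᶜ ∩ (openConn a₂ a₃)ᶜ) * (p₂ * (prodBernoulli w).real (((openConn a₂ a₁)ᶜ ∩ (openConn a₂ a₃)ᶜ) ∩ (openConn a₁ b ∪ openConn a₃ b))) := by rw [← hp₂]; ring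
      exact le_of_mul_le_mul_left key hv
  have gX13 : q * (prodBernoulli w).real (((openConn a₂ a₁)ᶜ ∩ (openConn a₂ a₃)ᶜ) ∩ ((openConn a₁ o ∪ openConn a₃ o) ∩ openConn a₂ b)) ≤ (q - p₂) * (prodBernoulli w).real (((openConn a₂ a₁)ᶜ ∩ (openConn a₂ a₃)ᶜ) ∩ openConn a₂ b) := by
    rcases eq_or_lt_of_le (hnn ((openConn a₂ a₁)ᶜ ∩ (openConn a₂ a₃)ᶜ)) with hv | hv
    · have h0 : (prodBernoulli w).real (((openConn a₂ a₁)ᶜ ∩ (openConn a₂ a₃)ᶜ) ∩ ((openConn a₁ o ∪ openConn a₃ o) ∩ openConn a₂ b)) = 0 := le_antisymm (by linarith) (hnn _)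
      have h1 : (prodBernoulli w).real (((openConn a₂ a₁)ᶜ ∩ (openConn a₂ a₃)ᶜ) ∩ openConn a₂ b) = 0 := le_antisymm (by linarith) (hnn _)
      rw [h0, h1]; simp
    · have hqv : (q - p₂) * (prodBernoulli w).real ((openConn a₂ a₁)ᶜ ∩ (openConn a₂ a₃)ᶜ) = q * (prodBernoulli w).real (((openConn a₂ a₁)ᶜ ∩ (openConn a₂ a₃)ᶜ) ∩ (openConn a₁ o ∪ openConn a₃ o)) := by linarith only [hq, hp₂]
      have key : (prodBernoulli w).real ((openConn a₂ a₁)ᶜ ∩ (openConn a₂ a₃)ᶜ) * (q * (prodBernoulli w).real (((openConn a₂ a₁)ᶜ ∩ (openConn a₂ a₃)ᶜ) ∩ ((openConn a₁ o ∪ openConn a₃ o) ∩ openConn a₂ b))) ≤ (prodBernoulli w).real ((openConn a₂ a₁)ᶜ ∩ (openConn a₂ a₃)ᶜ) * ((q - p₂) * (prodBernoulli w).real (((openConn a₂ a₁)ᶜ ∩ (openConn a₂ a₃)ᶜ) ∩ openConn a₂ b)) := by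
        calc (prodBernoulli w).real ((openConn a₂ a₁)ᶜ ∩ (openConn a₂ a₃)ᶜ) * (q * (prodBernoulli w).real (((openConn a₂ a₁)ᶜ ∩ (openConn a₂ a₃)ᶜ) ∩ ((openConn a₁ o ∪ openConn a₃ o) ∩ openConn a₂ b))) = q * ((prodBernoulli w).real ((openConn a₂ a₁)ᶜ ∩ (openConn a₂ a₃)ᶜ) * (prodBernoulli w).real (((openConn a₂ a₁)ᶜ ∩ (openConn a₂ a₃)ᶜ) ∩ ((openConn a₁ o ∪ openConn a₃ o) ∩ openConn a₂ b))) := by ring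
          _ ≤ q * ((prodBernoulli w).real (((openConn a₂ a₁)ᶜ ∩ (openConn a₂ a₃)ᶜ) ∩ (openConn a₁ o ∪ openConn a₃ o)) * (prodBernoulli w).real (((openConn a₂ a₁)ᶜ ∩ (openConn a₂ a₃)ᶜ) ∩ openConn a₂ b)) := mul_le_mul_of_nonneg_left X13 hq0
          _ = (q * (prodBernoulli w).real (((openConn a₂ a₁)ᶜ ∩ (openConn a₂ a₃)ᶜ) ∩ (openConn a₁ o ∪ openConn a₃ o))) * (prodBernoulli w).real (((openConn a₂ a₁)ᶜ ∩ (openConn a₂ a₃)ᶜ) ∩ openConn a₂ b) := by ring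
          _ = ((q - p₂) * (prodBernoulli w).real ((openConn a₂ a₁)ᶜ ∩ (openConn a₂ a₃)ᶜ)) * (prodBernoulli w).real (((openConn a₂ a₁)ᶜ ∩ (openConn a₂ a₃)ᶜ) ∩ openConn a₂ b) := by rw [hqv]
          _ = (prodBernoulli w).real ((openConn a₂ a₁)ᶜ ∩ (openConn a₂ a₃)ᶜ) * ((q - p₂) * (prodBernoulli w).real (((openConn a₂ a₁)ᶜ ∩ (openConn a₂ a₃)ᶜ) ∩ openConn a₂ b)) := by ring
      exact le_of_mul_le_mul_left key hv
  -- the ζ-identities `z_X' · v = z_X · u`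
  have gE1 : ((p₂ + Φ₁) * (prodBernoulli w).real (((openConn a₁ a₂)ᶜ ∩ (openConn a₁ a₃)ᶜ) ∩ openConn a₁ o) / (prodBernoulli w).real ((openConn a₁ a₂)ᶜ ∩ (openConn a₁ a₃)ᶜ)) * (prodBernoulli w).real ((openConn a₁ a₂)ᶜ ∩ (openConn a₁ a₃)ᶜ) = (p₂ + Φ₁) * (prodBernoulli w).real (((openConn a₁ a₂)ᶜ ∩ (openConn a₁ a₃)ᶜ) ∩ openConn a₁ o) := div_mul_cancel₀ _ hv₁.ne'
  have gE23 : (Φ₁ * (prodBernoulli w).real (((openConn a₁ a₂)ᶜ ∩ (openConn a₁ a₃)ᶜ) ∩ (openConn a₂ o ∪ openConn a₃ o)) / (prodBernoulli w).real ((openConn a₁ a₂)ᶜ ∩ (openConn a₁ a₃)ᶜ)) * (prodBernoulli w).real ((openConn a₁ a₂)ᶜ ∩ (openConn a₁ a₃)ᶜ) = Φ₁ * (prodBernoulli w).real (((openConn a₁ a₂)ᶜ ∩ (openConn a₁ a₃)ᶜ) ∩ (openConn a₂ o ∪ openConn a₃ o)) := div_mul_cancel₀ _ hv₁.ne'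
  have gE3 : ((p₂ + Φ₃) * (prodBernoulli w).real (((openConn a₃ a₁)ᶜ ∩ (openConn a₃ a₂)ᶜ) ∩ openConn a₃ o) / (prodBernoulli w).real ((openConn a₃ a₁)ᶜ ∩ (openConn a₃ a₂)ᶜ)) * (prodBernoulli w).real ((openConn a₃ a₁)ᶜ ∩ (openConn a₃ a₂)ᶜ) = (p₂ + Φ₃) * (prodBernoulli w).real (((openConn a₃ a₁)ᶜ ∩ (openConn a₃ a₂)ᶜ) ∩ openConn a₃ o) := div_mul_cancel₀ _ hv₃.ne'
  have gE12 : (Φ₃ * (prodBernoulli w).real (((openConn a₃ a₁)ᶜ ∩ (openConn a₃ a₂)ᶜ) ∩ (openConn a₁ o ∪ openConn a₂ o)) / (prodBernoulli w).real ((openConn a₃ a₁)ᶜ ∩ (openConn a₃ a₂)ᶜ)) * (prodBernoulli w).real ((openConn a₃ a₁)ᶜ ∩ (openConn a₃ a₂)ᶜ) = Φ₃ * (prodBernoulli w).real (((openConn a₃ a₁)ᶜ ∩ (openConn a₃ a₂)ᶜ) ∩ (openConn a₁ o ∪ openConn a₂ o)) := div_mul_cancel₀ _ hv₃.ne'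
  -- `S₁ ≤ Φ₁`, `S₃ ≤ Φ₃`
  have hS₁ : ((p₂ + Φ₁) * (prodBernoulli w).real (((openConn a₁ a₂)ᶜ ∩ (openConn a₁ a₃)ᶜ) ∩ openConn a₁ o) / (prodBernoulli w).real ((openConn a₁ a₂)ᶜ ∩ (openConn a₁ a₃)ᶜ)) + (Φ₁ * (prodBernoulli w).real (((openConn a₁ a₂)ᶜ ∩ (openConn a₁ a₃)ᶜ) ∩ (openConn a₂ o ∪ openConn a₃ o)) / (prodBernoulli w).real ((openConn a₁ a₂)ᶜ ∩ (openConn a₁ a₃)ᶜ)) ≤ Φ₁ := by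
    rw [← add_div, div_le_iff₀ hv₁]; linarith only [hΦ₁]
  have hS₃ : ((p₂ + Φ₃) * (prodBernoulli w).real (((openConn a₃ a₁)ᶜ ∩ (openConn a₃ a₂)ᶜ) ∩ openConn a₃ o) / (prodBernoulli w).real ((openConn a₃ a₁)ᶜ ∩ (openConn a₃ a₂)ᶜ)) + (Φ₃ * (prodBernoulli w).real (((openConn a₃ a₁)ᶜ ∩ (openConn a₃ a₂)ᶜ) ∩ (openConn a₁ o ∪ openConn a₂ o)) / (prodBernoulli w).real ((openConn a₃ a₁)ᶜ ∩ (openConn a₃ a₂)ᶜ)) ≤ Φ₃ := by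
    rw [← add_div, div_le_iff₀ hv₃]; linarith only [hΦ₃]
  -- pointwise certificate, integrated
  have hpt := fun ω => chartF2_pointwise_inst n o b a₁ a₂ a₃ p₂ q Φ₁ Φ₃ ((p₂ + Φ₁) * (prodBernoulli w).real (((openConn a₁ a₂)ᶜ ∩ (openConn a₁ a₃)ᶜ) ∩ openConn a₁ o) / (prodBernoulli w).real ((openConn a₁ a₂)ᶜ ∩ (openConn a₁ a₃)ᶜ)) (Φ₁ * (prodBernoulli w).real (((openConn a₁ a₂)ᶜ ∩ (openConn a₁ a₃)ᶜ) ∩ (openConn a₂ o ∪ openConn a₃ o)) / (prodBernoulli w).real ((openConn a₁ a₂)ᶜ ∩ (openConn a₁ a₃)ᶜ)) ((p₂ + Φ₃) * (prodBernoulli w).real (((openConn a₃ a₁)ᶜ ∩ (openConn a₃ a₂)ᶜ) ∩ openConn a₃ o) / (prodBernoulli w).real ((openConn a₃ a₁)ᶜ ∩ (openConn a₃ a₂)ᶜ)) (Φ₃ * (prodBernoulli w).real (((openConn a₃ a₁)ᶜ ∩ (openConn a₃ a₂)ᶜ) ∩ (openConn a₁ o ∪ openConn a₂ o)) / (prodBernoulli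 w).real ((openConn a₃ a₁)ᶜ ∩ (openConn a₃ a₂)ᶜ))
    hp₂0 hΦ₁0 hΦ₃0 hS₁ hS₃ condA condB ω
  have hint := stub_lincombIntegral_c7 n w _ hpt
  simp only [List.map_cons, List.map_nil, List.sum_cons, List.sum_nil, add_zero] at hint
  -- signs of the exchange terms
  have sT2 : 0 ≤ p₂ * ((prodBernoulli w).real (openConn a₂ b ∩ (openConn a₃ a₂)ᶜ) - (prodBernoulli w).real (openConn a₃ b ∩ (openConn a₃ a₂)ᶜ)) := mul_nonneg hp₂0 (by linarith only [T2])
  have sT1h : 0 ≤ (1 - p₂ - Φ₁ - Φ₃) * ((prodBernoulli w).real ((openConn a₁ b ∩ (openConn a₃ a₁)ᶜ) ∩ openConn a₁ o) - (prodBernoulli w).real ((openConn a₃ b ∩ (openConn a₃ a₁)ᶜ) ∩ openConn a₁ o)) :=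
    mul_nonneg (by linarith only [condA, hΦ₁0, hΦ₃0]) (by linarith only [T1h])
  have sT1a : 0 ≤ (Φ₁ + Φ₃) * ((prodBernoulli w).real ((openConn a₁ b ∩ (openConn a₃ a₁)ᶜ) ∩ (openConn a₃ o)ᶜ) - (prodBernoulli w).real ((openConn a₃ b ∩ (openConn a₃ a₁)ᶜ) ∩ (openConn a₃ o)ᶜ)) := mul_nonneg (by linarith only [hΦ₁0, hΦ₃0]) (by linarith only [T1a])
  linarith only [hint, gX2, gX13, gE1, gE23, gE3, gE12, sT2, sT1h, sT1a]

end Summit.CriticalPhenomena.PercolationContinuityZ3.Theorems
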